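import Mathlib

/-!
# TN-SB TOY (typing note «size-blind clause», CURRENCY-MEMO-g26 §9; critic idea-crit-5 #556 (5)) — a kernel-checked toy, NOT a refutation of any tree statement

On real-valued bond variables `U : ι → ℝ` (a toy: not `SU(2)`, no lattice geometry) take the «remainder»
`R_K(U) = Σ_{b,b′} K_{bb′}·σ(U_b)·σ(U_{b′})` with `σ` the unit step and `K ≥ 0`.  Then
* `clause_sizeBlind` : for every configuration `U`, every pair of DISTINCT bonds `b ≠ b′` and ALL move sizes `δ, δ′`, the one-bond-pair second
  difference of `R_K` is bounded by `K_{bb′} + K_{b′b}` — the organ's SIZE-BLIND pair clause holds with majorant `K + Kᵀ`, uniformly in the move size;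
* `coarse_pair_collects_total_mass` : through ANY full-support positive linear lift `(s, t) ↦ (x_b·s + y_b·t)_b` (entries `x_b, y_b > 0` as small as
  you like) the second difference in the two coarse variables at the datum `0` with ANY positive moves `s, t` (as small as you like) equals
  `−Σ_{b,b′} K_{bb′}` — the TOTAL mass, not a `|x|·K·|y|`-weighted (Hessian-type) quantity.
So a size-blind pair clause is not transported through a lift by ANY weighting of the response entries without a quantitative smoothness datum on `R`.
HONEST: a toy on `ℝ`-valued variables; the step-`R` is NOT claimed to arise from the runs' densities (which are pinned to trajectories and presumably
analytic à la Bałaban); nothing here refutes `OneStepContractionRun` or any tree statement; R3 = SU(2) YM₃ on T³ context only — NOT d = 4, NOT infinite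
volume, NOT a mass gap, NOT Clay.
-/

open Matrix BigOperators Finset

namespace Summit.QuantumFields.YangMills.Cruxes.FluctuationComparisonRegPrIntL.TNSBToy

variable {ι : Type*} [Fintype ι] [DecidableEq ι]

/-- The unit step. -/
noncomputable def σ (x : ℝ) : ℝ := if 0 < x then 1 else 0

theorem σ_of_pos {x : ℝ} (h : 0 < x) : σ x = 1 := by simp [σ, h]

theorem σ_zero : σ 0 = 0 := by simp [σ]

theorem σ_mem (x : ℝ) : σ x = 0 ∨ σ x = 1 := by
  unfold σ; split_ifs <;> simp

theorem abs_σ_sub_σ_le (x y : ℝ) : |σ x - σ y| ≤ 1 := by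
  rcases σ_mem x with h | h <;> rcases σ_mem y with h' | h' <;> simp [h, h']

/-- The quadratic form `v ↦ ⟨v, K v⟩`. -/
def quad (K : Matrix ι ι ℝ) (v : ι → ℝ) : ℝ := v ⬝ᵥ (K *ᵥ v)

/-- The toy remainder `R_K(U) = Σ_{b,b′} K_{bb′} σ(U_b) σ(U_{b′})`. -/
noncomputable def R (K : Matrix ι ι ℝ) (U : ι → ℝ) : ℝ := quad K (fun b => σ (U b))

omit [DecidableEq ι] in
/-- Polarisation: the mixed second difference of a quadratic form is the symmetrised bilinear form of the increments. -/
theorem quad_secondDiff (K : Matrix ι ι ℝ) (v a c : ι → ℝ) :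
    quad K (v + a + c) - quad K (v + a) - quad K (v + c) + quad K v = a ⬝ᵥ (K *ᵥ c) + c ⬝ᵥ (K *ᵥ a) := by
  simp only [quad, Matrix.mulVec_add, dotProduct_add, add_dotProduct]
  ring

theorem mulVec_single_apply (K : Matrix ι ι ℝ) (b' : ι) (β : ℝ) (i : ι) :
    (K *ᵥ (Pi.single b' β : ι → ℝ)) i = K i b' * β := by
  simp only [Matrix.mulVec, dotProduct, Pi.single_apply, mul_ite, mul_zero]
  rw [Finset.sum_ite_eq' Finset.univ b' (fun j => K i j * β)]
  simp

theorem single_quad_single (K : Matrix ι ι ℝ) (b b' : ι) (α β : ℝ) :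
    (Pi.single b α : ι → ℝ) ⬝ᵥ (K *ᵥ (Pi.single b' β : ι → ℝ)) = α * K b b' * β := by
  have h : (K *ᵥ (Pi.single b' β : ι → ℝ)) = fun i => K i b' * β := funext (mulVec_single_apply K b' β)
  rw [h, single_dotProduct]
  ring

omit [Fintype ι] in
/-- Moving one bond changes the step vector by a single-coordinate increment of modulus `≤ 1`. -/
theorem σvec_update (U : ι → ℝ) (b : ι) (x : ℝ) :
    (fun c => σ (Function.update U b x c)) = (fun c => σ (U c)) + Pi.single b (σ x - σ (U b)) := by
  funext c
  by_cases h : c = b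
  · subst h; simp
  · simp [Function.update_of_ne h, Pi.single_eq_of_ne h]

/-- ★ THE SIZE-BLIND PAIR CLAUSE HOLDS (majorant `K + Kᵀ`), for all configurations and ALL move sizes. -/
theorem clause_sizeBlind (K : Matrix ι ι ℝ) (hK : ∀ b b', 0 ≤ K b b') (U : ι → ℝ) {b b' : ι} (hbb : b ≠ b')
    (δ δ' : ℝ) :
    |R K (Function.update (Function.update U b (U b + δ)) b' (U b' + δ')) - R K (Function.update U b (U b + δ))
      - R K (Function.update U b' (U b' + δ')) + R K U| ≤ K b b' + K b' b := by
  set α : ℝ := σ (U b + δ) - σ (U b) with hα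
  set β : ℝ := σ (U b' + δ') - σ (U b') with hβ
  have hU₁ : (fun c => σ (Function.update U b (U b + δ) c)) = (fun c => σ (U c)) + Pi.single b α :=
    σvec_update U b (U b + δ)
  have hU₂ : (fun c => σ (Function.update U b' (U b' + δ') c)) = (fun c => σ (U c)) + Pi.single b' β :=
    σvec_update U b' (U b' + δ')
  have hb' : Function.update U b (U b + δ) b' = U b' := Function.update_of_ne (Ne.symm hbb) _ _
  have hU₃ : (fun c => σ (Function.update (Function.update U b (U b + δ)) b' (U b' + δ') c))
      = (fun c => σ (U c)) + Pi.single b α + Pi.single b' β := by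
    rw [σvec_update (Function.update U b (U b + δ)) b' (U b' + δ'), hb', hU₁]
  have key : R K (Function.update (Function.update U b (U b + δ)) b' (U b' + δ')) - R K (Function.update U b (U b + δ))
      - R K (Function.update U b' (U b' + δ')) + R K U = α * K b b' * β + β * K b' b * α := by
    simp only [R]
    rw [hU₃, hU₁, hU₂, quad_secondDiff, single_quad_single, single_quad_single]
  rw [key]
  have hαle : |α| ≤ 1 := abs_σ_sub_σ_le _ _
  have hβle : |β| ≤ 1 := abs_σ_sub_σ_le _ _
  have h1 : |α * K b b' * β| ≤ K b b' := by
    rw [abs_mul, abs_mul, abs_of_nonneg (hK b b')]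
    calc |α| * K b b' * |β| ≤ 1 * K b b' * 1 :=
          mul_le_mul (mul_le_mul_of_nonneg_right hαle (hK b b')) hβle (abs_nonneg _)
            (by rw [one_mul]; exact hK b b')
      _ = K b b' := by ring
  have h2 : |β * K b' b * α| ≤ K b' b := by
    rw [abs_mul, abs_mul, abs_of_nonneg (hK b' b)]
    calc |β| * K b' b * |α| ≤ 1 * K b' b * 1 :=
          mul_le_mul (mul_le_mul_of_nonneg_right hβle (hK b' b)) hαle (abs_nonneg _)
            (by rw [one_mul]; exact hK b' b)
      _ = K b' b := by ring
  exact (abs_add_le _ _).trans (add_le_add h1 h2)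

omit [DecidableEq ι] in
/-- ★★ THROUGH ANY FULL-SUPPORT POSITIVE LIFT, A COARSE PAIR COLLECTS THE TOTAL MASS — for arbitrarily small response entries `x, y > 0` and
arbitrarily small coarse moves `s, t > 0` at the datum `0`. -/
theorem coarse_pair_collects_total_mass (K : Matrix ι ι ℝ) (x y : ι → ℝ) (hx : ∀ b, 0 < x b) (hy : ∀ b, 0 < y b)
    {s t : ℝ} (hs : 0 < s) (ht : 0 < t) :
    R K (fun b => x b * s + y b * t) - R K (fun b => x b * s) - R K (fun b => y b * t) + R K (fun _ => 0)
      = -(∑ b, ∑ b', K b b') := by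
  have h1 : (fun b => σ (x b * s + y b * t)) = fun _ => (1 : ℝ) :=
    funext fun b => σ_of_pos (add_pos (mul_pos (hx b) hs) (mul_pos (hy b) ht))
  have h2 : (fun b => σ (x b * s)) = fun _ => (1 : ℝ) := funext fun b => σ_of_pos (mul_pos (hx b) hs)
  have h3 : (fun b => σ (y b * t)) = fun _ => (1 : ℝ) := funext fun b => σ_of_pos (mul_pos (hy b) ht)
  have h4 : (fun _ : ι => σ (0 : ℝ)) = fun _ => (0 : ℝ) := funext fun _ => σ_zero
  have hone : quad K (fun _ => (1 : ℝ)) = ∑ b, ∑ b', K b b' := by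
    simp [quad, dotProduct, Matrix.mulVec]
  have hzero : quad K (fun _ => (0 : ℝ)) = 0 := by
    simp [quad, dotProduct]
  simp only [R]
  rw [h1, h2, h3, h4, hone, hzero]
  ring

omit [DecidableEq ι] in
/-- The absolute coarse second difference equals the total mass when `K ≥ 0`. -/
theorem abs_coarse_pair_eq_total_mass (K : Matrix ι ι ℝ) (hK : ∀ b b', 0 ≤ K b b') (x y : ι → ℝ)
    (hx : ∀ b, 0 < x b) (hy : ∀ b, 0 < y b) {s t : ℝ} (hs : 0 < s) (ht : 0 < t) :
    |R K (fun b => x b * s + y b * t) - R K (fun b => x b * s) - R K (fun b => y b * t) + R K (fun _ => 0)|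
      = ∑ b, ∑ b', K b b' := by
  rw [coarse_pair_collects_total_mass K x y hx hy hs ht, abs_neg,
    abs_of_nonneg (Finset.sum_nonneg fun b _ => Finset.sum_nonneg fun b' _ => hK b b')]

end Summit.QuantumFields.YangMills.Cruxes.FluctuationComparisonRegPrIntL.TNSBToy
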